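import Literature.MathematicalPhysics.QuantumFieldTheory.Jegerlehner2017.SpectralFunctionInsertions
import Mathlib.Analysis.Complex.ExponentialBounds
import Mathlib.Analysis.Real.Pi.Bounds
import HarnessLib

/-!
# `Γ = 19 ≥ sup |γ₄|`: a uniform bound for the Källén–Sabry weight `γ₄(t) = ρ₄(t)(1 − t²)`
(venture QEDPrecision, cell `pub-qed`, literature seat, gen 13; folder `SpectralMajorants/`, file 2)

HONEST FRAMING (verbatim, venture QEDPrecision): independent recomputation; certified where stated,
statistical where stated; no new-physics claim.

## What this file is

§2.3 of the I(b)/I(c) certificate's premise note `certs/SetIbIc/repr/gl_bounds.md` ("`Γ := 19 ≥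
sup_{t∈[0,1]} |γ₄(t)|`") as a KERNEL inequality about the Lean-typed Källén–Sabry spectral density
`Literature.….Jegerlehner2017.rho4` (book (3.160), VERBATIM, `Li₂ := realDilog`):

* `abs_rho4_mul_one_sub_sq_le` : for `0 ≤ t < 1`, `|ρ₄(t)·(1 − t²)| ≤ 19`.

The proof is the note's TERMWISE estimate, with every step an elementary inequality: writing
`γ₄ = (2t/3)·(A·Br + T₂·L + T₃ + T₄)` (`A = (3−t²)(1+t²)/2 ∈ [0,2]`; `Br = ζ₂ + ℓ₂L + D` with
`0 ≤ Li₂ ≤ ζ₂` on `[0,1]` termwise (`realDilog_nonneg`, `realDilog_le`), `ℓ₂ = ln((1+t)/2) ∈ [(t−1)/(1+t), 0]`,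
`L = ln((1+t)/(1−t)) ∈ [0, 2t/(1−t)]`, hence `ℓ₂L ∈ [−1, 0]` and `|Br| ≤ π²`; `T₂ = (1−t)Q/16`,
`Q = 33 − 39t − 17t² + 7t³`, `|Q·t| ≤ 16`, hence `|T₂L| ≤ 2`; `T₃ = t(3−t²)(3ℓ₂ − 2 ln t)` with
`t(3−t²) ≤ 2`, `−ln 2 ≤ ℓ₂ ≤ 0`, `0 ≤ −t ln t ≤ 1/e`, hence `|T₃| ≤ 6 ln 2`; `0 ≤ T₄ = (3/8)t(5−3t²) ≤ 15/8`),
so `|γ₄| ≤ (2/3)(2π² + 2 + 6 ln 2 + 15/8) < 19` by Mathlib's `π < 3.15`, `ln 2 < 0.6931471808`,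
`e > 2.7182818283`.  (The note's own constants are slightly different — it uses `L ≤ 2t/(1−t²)` and
`|T₂L| ≤ 33/16`, `T₃ ≤ 6/e`, `T₄ ≤ 0.932` — and reach `17.93 ≤ 19`; ours reach `18.59 ≤ 19`.  Only the
printed constant `Γ = 19` matters downstream.)

NEW WORK of the cell (elementary analysis about the cell's typed objects), not a published result; nothing
here is cited as a fact anywhere; no numerical value of any anomaly integral is asserted.  Not an R-row.
-/

noncomputable section

open Real Set

namespace Summit.Ventures.QEDPrecision.SpectralMajorants

open Literature.MathematicalPhysics.QuantumFieldTheory.Jegerlehner2017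
open Literature.Analysis.SpecialFunctions (realDilog)

/-! ### `0 ≤ Li₂(x) ≤ ζ₂ = π²/6` on `[0,1]` for the series dilogarithm -/

/-- The shifted Basel series `Σₙ 1/(n+1)² = π²/6`. -/
theorem hasSum_inv_nat_add_one_sq :
    HasSum (fun n : ℕ => 1 / ((n : ℝ) + 1) ^ 2) (π ^ 2 / 6) := by
  have h := (hasSum_nat_add_iff' 1).mpr hasSum_zeta_two
  simpa [Finset.sum_range_one] using h

/-- Termwise domination of the dilogarithm series on `[0,1]`: `0 ≤ xⁿ⁺¹/(n+1)² ≤ 1/(n+1)²`. -/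
theorem realDilog_term_bounds {x : ℝ} (h0 : 0 ≤ x) (h1 : x ≤ 1) (n : ℕ) :
    0 ≤ x ^ (n + 1) / ((n : ℝ) + 1) ^ 2 ∧ x ^ (n + 1) / ((n : ℝ) + 1) ^ 2 ≤ 1 / ((n : ℝ) + 1) ^ 2 := by
  refine ⟨by positivity, ?_⟩
  exact div_le_div_of_nonneg_right (pow_le_one₀ h0 h1) (by positivity)

/-- The dilogarithm series converges (absolutely) on `[0,1]`. -/
theorem summable_realDilog_term {x : ℝ} (h0 : 0 ≤ x) (h1 : x ≤ 1) :
    Summable fun n : ℕ => x ^ (n + 1) / ((n : ℝ) + 1) ^ 2 :=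
  Summable.of_nonneg_of_le (fun n => (realDilog_term_bounds h0 h1 n).1)
    (fun n => (realDilog_term_bounds h0 h1 n).2) hasSum_inv_nat_add_one_sq.summable

/-- `Li₂(x) ≥ 0` for `0 ≤ x ≤ 1`. -/
theorem realDilog_nonneg {x : ℝ} (h0 : 0 ≤ x) (h1 : x ≤ 1) : 0 ≤ realDilog x :=
  tsum_nonneg fun n => (realDilog_term_bounds h0 h1 n).1

/-- `Li₂(x) ≤ ζ₂ = π²/6` for `0 ≤ x ≤ 1`. -/
theorem realDilog_le {x : ℝ} (h0 : 0 ≤ x) (h1 : x ≤ 1) : realDilog x ≤ π ^ 2 / 6 := by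
  unfold realDilog
  rw [← hasSum_inv_nat_add_one_sq.tsum_eq]
  exact (summable_realDilog_term h0 h1).tsum_le_tsum (fun n => (realDilog_term_bounds h0 h1 n).2)
    hasSum_inv_nat_add_one_sq.summable

/-! ### Elementary logarithmic brackets on `(0,1)` -/

/-- `L = ln((1+t)/(1−t)) ≥ 0`. -/
theorem log_ratio_nonneg {t : ℝ} (ht0 : 0 ≤ t) (ht1 : t < 1) : 0 ≤ log ((1 + t) / (1 - t)) := by
  apply log_nonneg
  rw [le_div_iff₀ (by linarith)]
  linarith

/-- `L = ln((1+t)/(1−t)) ≤ 2t/(1−t)` (`ln y ≤ y − 1`). -/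
theorem log_ratio_le {t : ℝ} (ht0 : 0 ≤ t) (ht1 : t < 1) :
    log ((1 + t) / (1 - t)) ≤ 2 * t / (1 - t) := by
  have h1t : 0 < 1 - t := by linarith
  have h := log_le_sub_one_of_pos (div_pos (by linarith : (0:ℝ) < 1 + t) h1t)
  have e : (1 + t) / (1 - t) - 1 = 2 * t / (1 - t) := by field_simp; ring
  linarith [h, e.le, e.ge]

/-- `ℓ₂ = ln((1+t)/2) ≤ 0`. -/
theorem log_half_add_nonpos {t : ℝ} (ht0 : 0 ≤ t) (ht1 : t ≤ 1) : log ((1 + t) / 2) ≤ 0 :=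
  log_nonpos (by linarith) (by linarith)

/-- `ℓ₂ = ln((1+t)/2) ≥ (t−1)/(1+t)` (`1 − 1/y ≤ ln y`). -/
theorem log_half_add_ge {t : ℝ} (ht0 : 0 ≤ t) :
    (t - 1) / (1 + t) ≤ log ((1 + t) / 2) := by
  have hpos : 0 < (1 + t) / 2 := by linarith
  have h := one_sub_inv_le_log_of_pos hpos
  have e : 1 - ((1 + t) / 2)⁻¹ = (t - 1) / (1 + t) := by
    have : (1 + t) ≠ 0 := by linarith
    field_simp; ring
  linarith [h, e.le, e.ge]

/-- `ℓ₂ = ln((1+t)/2) ≥ −ln 2`. -/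
theorem log_half_add_ge_neg_log_two {t : ℝ} (ht0 : 0 ≤ t) : -log 2 ≤ log ((1 + t) / 2) := by
  rw [log_div (by linarith) two_ne_zero]
  linarith [log_nonneg (by linarith : (1:ℝ) ≤ 1 + t)]

/-- `0 ≤ −t ln t ≤ 1/e` on `(0,1]`: here the upper bound, from `ln y ≤ y − 1` at `y = 1/(e t)`. -/
theorem neg_mul_log_le {t : ℝ} (ht0 : 0 < t) : -(t * log t) ≤ 1 / exp 1 := by
  have he : 0 < exp 1 := exp_pos 1
  have hy : 0 < 1 / (exp 1 * t) := by positivity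
  have h := log_le_sub_one_of_pos hy
  rw [one_div, log_inv, log_mul he.ne' ht0.ne', log_exp] at h
  -- h : -(1 + log t) ≤ (exp 1 * t)⁻¹ - 1, i.e. −log t ≤ 1/(e t)
  have h2 : -log t ≤ (exp 1 * t)⁻¹ := by linarith
  have h3 : t * (-log t) ≤ t * (exp 1 * t)⁻¹ := mul_le_mul_of_nonneg_left h2 ht0.le
  have e : t * (exp 1 * t)⁻¹ = 1 / exp 1 := by field_simp
  linarith [h3, e.le]

/-! ### The pieces of `ρ₄` and their brackets -/

/-- `A = (3−t²)(1+t²)/2 ∈ [0, 2]` on `[0,1]`. -/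
theorem ksA_bounds {t : ℝ} (ht0 : 0 ≤ t) (ht1 : t ≤ 1) :
    0 ≤ (3 - t ^ 2) * (1 + t ^ 2) / 2 ∧ (3 - t ^ 2) * (1 + t ^ 2) / 2 ≤ 2 := by
  have ht2 : t ^ 2 ≤ 1 := pow_le_one₀ ht0 ht1
  constructor
  · have : 0 ≤ 3 - t ^ 2 := by linarith
    positivity
  · nlinarith [sq_nonneg (t ^ 2 - 1)]

/-- The dilogarithm bracket `Br = ζ₂ + ℓ₂L + D` of (3.160) satisfies `|Br| ≤ π²` on `[0,1)`. -/
theorem abs_bracket_le {t : ℝ} (ht0 : 0 ≤ t) (ht1 : t < 1) :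
    |realDilog 1 + log ((1 + t) / 2) * log ((1 + t) / (1 - t))
        + 2 * (realDilog ((1 - t) / (1 + t)) + realDilog ((1 + t) / 2) - realDilog ((1 - t) / 2))
        - 4 * realDilog t + realDilog (t ^ 2)| ≤ π ^ 2 := by
  have hz1 : realDilog 1 = π ^ 2 / 6 := Literature.Analysis.SpecialFunctions.realDilog_one
  have h1t : 0 < 1 - t := by linarith
  have h1t' : 0 < 1 + t := by linarith
  -- the five dilogarithms, each in [0, π²/6]
  have a1l : 0 ≤ (1 - t) / (1 + t) := by positivity
  have a1u : (1 - t) / (1 + t) ≤ 1 := by rw [div_le_one h1t']; linarith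
  have a2l : 0 ≤ (1 + t) / 2 := by positivity
  have a2u : (1 + t) / 2 ≤ 1 := by linarith
  have a3l : 0 ≤ (1 - t) / 2 := by positivity
  have a3u : (1 - t) / 2 ≤ 1 := by linarith
  have a5l : 0 ≤ t ^ 2 := by positivity
  have a5u : t ^ 2 ≤ 1 := pow_le_one₀ ht0 ht1.le
  have d1l := realDilog_nonneg a1l a1u
  have d1u := realDilog_le a1l a1u
  have d2l := realDilog_nonneg a2l a2u
  have d2u := realDilog_le a2l a2u
  have d3l := realDilog_nonneg a3l a3u
  have d3u := realDilog_le a3l a3u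
  have d4l := realDilog_nonneg ht0 ht1.le
  have d4u := realDilog_le ht0 ht1.le
  have d5l := realDilog_nonneg a5l a5u
  have d5u := realDilog_le a5l a5u
  -- ℓ₂ L ∈ [−1, 0]
  have hL0 := log_ratio_nonneg ht0 ht1
  have hLu := log_ratio_le ht0 ht1
  have hl0 := log_half_add_nonpos ht0 ht1.le
  have hll := log_half_add_ge ht0
  have hprod_u : log ((1 + t) / 2) * log ((1 + t) / (1 - t)) ≤ 0 :=
    mul_nonpos_of_nonpos_of_nonneg hl0 hL0
  have hprod_l : -1 ≤ log ((1 + t) / 2) * log ((1 + t) / (1 - t)) := by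
    -- ℓ₂ L ≥ ((t−1)/(1+t)) · (2t/(1−t)) = −2t/(1+t) ≥ −1
    have h1 : (t - 1) / (1 + t) * log ((1 + t) / (1 - t))
        ≤ log ((1 + t) / 2) * log ((1 + t) / (1 - t)) :=
      mul_le_mul_of_nonneg_right hll hL0
    have hneg : (t - 1) / (1 + t) ≤ 0 := div_nonpos_of_nonpos_of_nonneg (by linarith) h1t'.le
    have h2 : (t - 1) / (1 + t) * (2 * t / (1 - t)) ≤ (t - 1) / (1 + t) * log ((1 + t) / (1 - t)) :=
      mul_le_mul_of_nonpos_left hLu hneg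
    have e : (t - 1) / (1 + t) * (2 * t / (1 - t)) = -(2 * t / (1 + t)) := by
      field_simp; ring
    have h3 : 2 * t / (1 + t) ≤ 1 := by rw [div_le_one h1t']; linarith
    linarith
  have hpi : 6 ≤ π ^ 2 := by nlinarith [pi_gt_three]
  rw [abs_le]
  constructor <;> nlinarith

/-- `|T₂·L| ≤ 2` on `[0,1)`, where `T₂ = (1−t)(33 − 39t − 17t² + 7t³)/16`. -/
theorem abs_ksT2_mul_log_le {t : ℝ} (ht0 : 0 ≤ t) (ht1 : t < 1) :
    |(11 / 16 * (3 - t ^ 2) * (1 + t ^ 2) + t ^ 4 / 4 - 3 / 2 * t * (3 - t ^ 2))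
        * log ((1 + t) / (1 - t))| ≤ 2 := by
  have h1t : 0 < 1 - t := by linarith
  have hT2 : 11 / 16 * (3 - t ^ 2) * (1 + t ^ 2) + t ^ 4 / 4 - 3 / 2 * t * (3 - t ^ 2)
      = (1 - t) * (33 - 39 * t - 17 * t ^ 2 + 7 * t ^ 3) / 16 := by ring
  rw [hT2]
  have hL0 := log_ratio_nonneg ht0 ht1
  have hLu := log_ratio_le ht0 ht1
  -- (1 − t) L ∈ [0, 2t]
  have hM0 : 0 ≤ (1 - t) * log ((1 + t) / (1 - t)) := mul_nonneg h1t.le hL0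
  have hMu : (1 - t) * log ((1 + t) / (1 - t)) ≤ 2 * t := by
    have h := mul_le_mul_of_nonneg_left hLu h1t.le
    have e : (1 - t) * (2 * t / (1 - t)) = 2 * t := by field_simp
    linarith
  -- |Q| (1−t) L ≤ |Q| · 2t and |Q t| ≤ 16
  have hQt_u : (33 - 39 * t - 17 * t ^ 2 + 7 * t ^ 3) * t ≤ 16 := by
    nlinarith [mul_nonneg ht0 ht0, pow_nonneg ht0 3, pow_nonneg ht0 4, mul_nonneg (pow_nonneg ht0 2) h1t.le]
  have hQt_l : -16 ≤ (33 - 39 * t - 17 * t ^ 2 + 7 * t ^ 3) * t := by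
    -- 7t⁴ − 17t³ − 39t² + 33t + 16 = (1−t)(−7t³ + 10t² + 49t + 16) ≥ 0
    have h2 : 0 ≤ -7 * t ^ 3 + 10 * t ^ 2 + 49 * t + 16 := by
      nlinarith [pow_le_one₀ ht0 ht1.le (n := 3), pow_nonneg ht0 2]
    nlinarith [mul_nonneg h1t.le h2]
  rw [abs_le]
  set Q := 33 - 39 * t - 17 * t ^ 2 + 7 * t ^ 3 with hQ
  set M := (1 - t) * log ((1 + t) / (1 - t)) with hM
  have e : (1 - t) * Q / 16 * log ((1 + t) / (1 - t)) = Q * M / 16 := by rw [hM]; ring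
  rw [e]
  -- Q M ≤ ? : if Q ≥ 0 then Q M ≤ Q·2t ≤ 32; if Q ≤ 0 then Q M ≤ 0.  Q M ≥ ? : if Q ≥ 0 then ≥ 0; else ≥ Q·2t ≥ −32.
  constructor
  · rcases le_or_gt 0 Q with hq | hq
    · nlinarith [mul_nonneg hq hM0]
    · have : Q * (2 * t) ≤ Q * M := mul_le_mul_of_nonpos_left hMu hq.le
      nlinarith
  · rcases le_or_gt 0 Q with hq | hq
    · have : Q * M ≤ Q * (2 * t) := mul_le_mul_of_nonneg_left hMu hq
      nlinarith
    · nlinarith [mul_nonpos_of_nonpos_of_nonneg hq.le hM0]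

/-- `|T₃| ≤ 6 ln 2` on `(0,1]`, `T₃ = t(3−t²)(3 ln((1+t)/2) − 2 ln t)`. -/
theorem abs_ksT3_le {t : ℝ} (ht0 : 0 < t) (ht1 : t ≤ 1) :
    |t * (3 - t ^ 2) * (3 * log ((1 + t) / 2) - 2 * log t)| ≤ 6 * log 2 := by
  have hl0 := log_half_add_nonpos ht0.le ht1
  have hll := log_half_add_ge_neg_log_two ht0.le
  have hlogt : log t ≤ 0 := log_nonpos ht0.le ht1
  have hm := neg_mul_log_le ht0
  have hc0 : 0 ≤ t * (3 - t ^ 2) := by nlinarith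
  have hc2 : t * (3 - t ^ 2) ≤ 2 := by nlinarith [sq_nonneg (t - 1), mul_pos ht0 ht0]
  have hlog2 : (0.6931471803 : ℝ) < log 2 := log_two_gt_d9
  have he : (2.7182818283 : ℝ) < exp 1 := exp_one_gt_d9
  have hinv : 1 / exp 1 < 0.37 := by
    rw [div_lt_iff₀ (exp_pos 1)]; nlinarith
  -- split: T₃ = 3·[t(3−t²)]·ℓ₂ + 2(3−t²)·(−t ln t)
  have e : t * (3 - t ^ 2) * (3 * log ((1 + t) / 2) - 2 * log t)
      = 3 * (t * (3 - t ^ 2)) * log ((1 + t) / 2) + 2 * (3 - t ^ 2) * (-(t * log t)) := by ring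
  rw [e, abs_le]
  have h3t : 0 ≤ 3 - t ^ 2 := by nlinarith
  have h3t' : 3 - t ^ 2 ≤ 3 := by nlinarith
  have p1u : 3 * (t * (3 - t ^ 2)) * log ((1 + t) / 2) ≤ 0 := by
    have := mul_nonpos_of_nonneg_of_nonpos hc0 hl0
    nlinarith
  have p1l : -(6 * log 2) ≤ 3 * (t * (3 - t ^ 2)) * log ((1 + t) / 2) := by
    -- t(3−t²) ℓ₂ ≥ 2·(−ln 2) since 0 ≤ t(3−t²) ≤ 2 and −ln2 ≤ ℓ₂ ≤ 0
    have h1 : t * (3 - t ^ 2) * (-log 2) ≤ t * (3 - t ^ 2) * log ((1 + t) / 2) :=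
      mul_le_mul_of_nonneg_left hll hc0
    have h2 : 2 * (-log 2) ≤ t * (3 - t ^ 2) * (-log 2) := by nlinarith
    nlinarith
  have p2l : 0 ≤ 2 * (3 - t ^ 2) * (-(t * log t)) := by
    have : 0 ≤ -(t * log t) := by nlinarith [mul_nonpos_of_nonneg_of_nonpos ht0.le hlogt]
    positivity
  have p2u : 2 * (3 - t ^ 2) * (-(t * log t)) ≤ 6 * (1 / exp 1) := by
    have h1 : 2 * (3 - t ^ 2) * (-(t * log t)) ≤ 2 * (3 - t ^ 2) * (1 / exp 1) :=
      mul_le_mul_of_nonneg_left hm (by positivity)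
    have h2 : 2 * (3 - t ^ 2) * (1 / exp 1) ≤ 6 * (1 / exp 1) := by
      have : 0 ≤ 1 / exp 1 := by positivity
      nlinarith
    linarith
  constructor <;> nlinarith

/-- `0 ≤ T₄ = (3/8)t(5−3t²) ≤ 15/8` on `[0,1]`. -/
theorem ksT4_bounds {t : ℝ} (ht0 : 0 ≤ t) (ht1 : t ≤ 1) :
    0 ≤ 3 / 8 * t * (5 - 3 * t ^ 2) ∧ 3 / 8 * t * (5 - 3 * t ^ 2) ≤ 15 / 8 := by
  have ht2 : t ^ 2 ≤ 1 := pow_le_one₀ ht0 ht1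
  constructor
  · have : 0 ≤ 5 - 3 * t ^ 2 := by linarith
    positivity
  · nlinarith [mul_nonneg ht0 (sq_nonneg t)]

/-! ### The bound -/

/-- `γ₄ = ρ₄(1−t²)` factorises as `(2t/3)·H` off `t = ±1`. -/
theorem rho4_mul_one_sub_sq_eq {t : ℝ} (ht : 1 - t ^ 2 ≠ 0) :
    rho4 t * (1 - t ^ 2) = 2 * t / 3 *
      ((3 - t ^ 2) * (1 + t ^ 2) / 2 *
          (realDilog 1 + log ((1 + t) / 2) * log ((1 + t) / (1 - t))
            + 2 * (realDilog ((1 - t) / (1 + t)) + realDilog ((1 + t) / 2) - realDilog ((1 - t) / 2))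
            - 4 * realDilog t + realDilog (t ^ 2))
        + (11 / 16 * (3 - t ^ 2) * (1 + t ^ 2) + t ^ 4 / 4 - 3 / 2 * t * (3 - t ^ 2))
          * log ((1 + t) / (1 - t))
        + t * (3 - t ^ 2) * (3 * log ((1 + t) / 2) - 2 * log t)
        + 3 / 8 * t * (5 - 3 * t ^ 2)) := by
  unfold rho4
  field_simp

/-- **`Γ = 19`** (gl_bounds.md §2.3): for `0 ≤ t < 1`, `|ρ₄(t)(1 − t²)| ≤ 19`. -/
theorem abs_rho4_mul_one_sub_sq_le {t : ℝ} (ht0 : 0 ≤ t) (ht1 : t < 1) :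
    |rho4 t * (1 - t ^ 2)| ≤ 19 := by
  rcases eq_or_lt_of_le ht0 with h | ht0'
  · subst h
    simp [rho4]
  have h1t2 : 1 - t ^ 2 ≠ 0 := by nlinarith
  rw [rho4_mul_one_sub_sq_eq h1t2]
  set A := (3 - t ^ 2) * (1 + t ^ 2) / 2 with hA
  set Br := realDilog 1 + log ((1 + t) / 2) * log ((1 + t) / (1 - t))
      + 2 * (realDilog ((1 - t) / (1 + t)) + realDilog ((1 + t) / 2) - realDilog ((1 - t) / 2))
      - 4 * realDilog t + realDilog (t ^ 2) with hBr
  set T2L := (11 / 16 * (3 - t ^ 2) * (1 + t ^ 2) + t ^ 4 / 4 - 3 / 2 * t * (3 - t ^ 2))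
      * log ((1 + t) / (1 - t)) with hT2L
  set T3 := t * (3 - t ^ 2) * (3 * log ((1 + t) / 2) - 2 * log t) with hT3
  set T4 := 3 / 8 * t * (5 - 3 * t ^ 2) with hT4
  have hA' := ksA_bounds ht0 ht1.le
  have hBr' := abs_bracket_le ht0 ht1
  have hT2' := abs_ksT2_mul_log_le ht0 ht1
  have hT3' := abs_ksT3_le ht0' ht1.le
  have hT4' := ksT4_bounds ht0 ht1.le
  have hpi : π ^ 2 < 9.9225 := by nlinarith [pi_lt_d2, pi_gt_three]
  have hlog2 : log 2 < 0.6931471808 := log_two_lt_d9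
  -- |A·Br| ≤ 2π²
  have hABr : |A * Br| ≤ 2 * π ^ 2 := by
    rw [abs_mul, abs_of_nonneg hA'.1]
    nlinarith [abs_nonneg Br]
  have hH : |A * Br + T2L + T3 + T4| ≤ 2 * π ^ 2 + 2 + 6 * log 2 + 15 / 8 := by
    have hT4abs : |T4| ≤ 15 / 8 := by rw [abs_of_nonneg hT4'.1]; exact hT4'.2
    calc |A * Br + T2L + T3 + T4| ≤ |A * Br + T2L + T3| + |T4| := abs_add_le _ _
      _ ≤ |A * Br + T2L| + |T3| + |T4| := by linarith [abs_add_le (A * Br + T2L) T3]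
      _ ≤ |A * Br| + |T2L| + |T3| + |T4| := by linarith [abs_add_le (A * Br) T2L]
      _ ≤ 2 * π ^ 2 + 2 + 6 * log 2 + 15 / 8 := by linarith
  have ht23 : |2 * t / 3| ≤ 2 / 3 := by
    rw [abs_of_nonneg (by positivity)]; linarith
  calc |2 * t / 3 * (A * Br + T2L + T3 + T4)|
      = |2 * t / 3| * |A * Br + T2L + T3 + T4| := abs_mul _ _
    _ ≤ 2 / 3 * (2 * π ^ 2 + 2 + 6 * log 2 + 15 / 8) :=
        mul_le_mul ht23 hH (abs_nonneg _) (by norm_num)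
    _ ≤ 19 := by nlinarith

/-- The same with the note's letter: `Γ := 19`, `|γ₄ t| ≤ Γ` for `t ∈ [0,1)`. -/
theorem abs_rho4_mul_one_sub_sq_le_of_mem {t : ℝ} (ht : t ∈ Ico (0:ℝ) 1) :
    |rho4 t * (1 - t ^ 2)| ≤ 19 :=
  abs_rho4_mul_one_sub_sq_le ht.1 ht.2

end Summit.Ventures.QEDPrecision.SpectralMajorants

end
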